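import Summits.CriticalPhenomena.SAWScalingLimit.Theorems.SAWDevelopingMapInteriorFlatteningOneMouthDefs
import Summits.CriticalPhenomena.SAWScalingLimit.Theses.SAWDevelopingMap
import Literature.Probability.RandomPlanarGeometry.HexParafermionSpinShift
import Literature.Probability.RandomPlanarGeometry.HexParafermionProofs
import Literature.Probability.LatticeModels.HexStarDirections

/-!
# The spin dictionary for the crux `InteriorFlattening` (stmt-CriticalPhenomena-8297) and its clean core S4

Lead prover `prover-line-stmt-CriticalPhenomena-8297-0`, line `one-mouth-ball-reduction`, the lead's own stub
`stub_oneMouthBallFlattening` (S4). TOOL, not a closure: by the spin-shift identity of the Duminil-Copin–Smirnov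
observable (`Literature/…/HexParafermionSpinShift.lean`: `F(a,{v,t},x,σ∓2) = ((c t - c v)/(c w₁ - c u))^{±2} F(a,{v,t},x,σ)`),
the two orientation classes of a labelled star (`Literature/…/HexStarDirections.lean`) and DCS Lemma 1
(`DuminilCopinSmirnov2012_lemma1_holds`), the Beltrami mode of the crux at a vertex `v` of a simply connected
domain with a boundary root is EITHER `0` (counter-clockwise labellings: Lemma 1) OR, in norm, the spin `-11/8`
STAR SUM `Σⱼ F(a, {v,wⱼ}, x_c, -11/8)` (clockwise labellings), while the monopole is the spin `5/8` star sum.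
Hence (`bel_dichotomy`, `norm_bel_le_norm_starSum`, `norm_starSum_eq_norm_bel_or`):

* `oneMouthBallFlattening_iff_twoPoint` — S4 is EQUIVALENT to its two-point form: `∀ η e ∃ r₀ ∀ r ≥ r₀`, for every
  one-mouth ball `D` (simply connected, `B(v,ηr) ⊆ D ⊆ B(v,r)`, rooted at an entrance dart) ONE inequality
  `‖Σⱼ F_{-11/8}{v,wⱼ}‖ ≤ e ‖Σⱼ F_{5/8}{v,wⱼ}‖` for ONE positive arrival-winding law per vertex (no labellings, no
  vectors; registered sub-goal of the crux);
* `interiorFlattening_iff_twoPoint` — the same for the crux (M) itself (= the transfer `C⁺ ↔ crux` of the sibling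
  line `winding-zero-condensation`, here proved; registered sub-goal).

Sources: H. Duminil-Copin, S. Smirnov, Ann. of Math. 175 (2012) (arXiv:1007.0575), Lemma 1 and the curl remark
p. 7; the crux's Disproof.lean §C1 (winding-law form) and TRIAGE-r1-3 (key identity), both on the item.
-/

noncomputable section

open scoped BigOperators
open Literature.Probability.LatticeModels Literature.Probability.RandomPlanarGeometry.SAW

namespace Summit.CriticalPhenomena.SAWScalingLimit.Theorems.InteriorFlattening.OneMouth

/-! ### Constants -/

/-- `ω = e^{2πi/3} = ζ²`. -/
theorem omega_eq_triZeta_sq : omega = triZeta ^ 2 := by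
  rw [omega, triZeta, sq, ← Complex.exp_add]
  congr 1
  ring

/-- The crux's `ω` (`Complex.exp (2πi/3)`) is `ζ²`. -/
theorem cexp_two_pi_I_div_three : Complex.exp (2 * Real.pi * Complex.I / 3) = triZeta ^ 2 :=
  omega_eq_triZeta_sq

/-- `x_c` of the Defs module is DCS's `1/√(2+√2)`. -/
theorem xc_eq : (xc : ℝ) = (Real.sqrt (2 + Real.sqrt 2))⁻¹ := rfl

/-! ### The dichotomy of a labelled star -/

/-- **Lemma 1 in mode form.** For a simply connected `Λ`, a boundary root `{u, c₀}` (`u ∉ Λ`, `c₀ ∈ Λ`,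
`u ∼ c₀`), `v ∈ Λ` and a COUNTER-CLOCKWISE labelling (`c w₁ - c v = ζ²(c w₀ - c v)`,
`c w₂ - c v = ζ⁴(c w₀ - c v)`): `F{v,w₀} + ω F{v,w₁} + ω² F{v,w₂} = 0`. -/
theorem bel_eq_zero_of_ccw {Λ : Finset HexVertex} {u c₀ v w₀ w₁ w₂ : HexVertex}
    (hΛ : hexDomainSimplyConnected Λ) (hu : u ∉ Λ) (hc₀ : c₀ ∈ Λ) (huc : hexGraph.Adj u c₀) (hv : v ∈ Λ)
    (h : IsStar v w₀ w₁ w₂)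
    (hd₁ : hexCenter w₁ - hexCenter v = triZeta ^ 2 * (hexCenter w₀ - hexCenter v))
    (hd₂ : hexCenter w₂ - hexCenter v = triZeta ^ 4 * (hexCenter w₀ - hexCenter v)) :
    bel Λ s(u, c₀) v w₀ w₁ w₂ = 0 := by
  obtain ⟨h₀, h₁, h₂, h01, h12, h02⟩ := h
  have ha : s(u, c₀) ∈ hexDomainBoundary Λ :=
    ⟨(SimpleGraph.mem_edgeSet _).2 huc, u, c₀, rfl, hc₀, hu⟩
  have L := DuminilCopinSmirnov2012_lemma1_holds Λ hΛ _ ha v hv w₀ w₁ w₂ h₀ h₁ h₂ h01 h12 h02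
  -- the three coefficients are `ρ/2, ζ²ρ/2, ζ⁴ρ/2`
  have e₀ : hexMidpoint s(v, w₀) - hexCenter v = (hexCenter w₀ - hexCenter v) / 2 := by
    rw [hexMidpoint_mk]; ring
  have e₁ : hexMidpoint s(v, w₁) - hexCenter v = triZeta ^ 2 * (hexCenter w₀ - hexCenter v) / 2 := by
    rw [hexMidpoint_mk, ← hd₁]; ring
  have e₂ : hexMidpoint s(v, w₂) - hexCenter v = triZeta ^ 4 * (hexCenter w₀ - hexCenter v) / 2 := by
    rw [hexMidpoint_mk, ← hd₂]; ring
  rw [e₀, e₁, e₂, ← xc_eq] at L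
  have hρ : hexCenter w₀ - hexCenter v ≠ 0 := sub_ne_zero.2 (hexCenter_ne_of_adj h₀).symm
  unfold bel Fobs
  rw [omega_eq_triZeta_sq, ← pow_mul]
  have : (hexCenter w₀ - hexCenter v) / 2 *
      (hexParafermionicObservable Λ s(u, c₀) xc (5 / 8) s(v, w₀) +
        triZeta ^ 2 * hexParafermionicObservable Λ s(u, c₀) xc (5 / 8) s(v, w₁) +
        triZeta ^ (2 * 2) * hexParafermionicObservable Λ s(u, c₀) xc (5 / 8) s(v, w₂)) = 0 := by
    rw [← L]; ring
  rcases mul_eq_zero.1 this with h | h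
  · exact absurd (div_eq_zero_iff.1 h) (by simp [hρ])
  · exact h

/-- **The clockwise Beltrami mode is the spin `-11/8` star sum** (up to the unimodular factor
`((c c₀ - c u)/(c w₀ - c v))²`): for a root `{u, c₀}` with `u ∉ Λ` and a CLOCKWISE labelling
(`c w₁ - c v = ζ⁴(c w₀ - c v)`, `c w₂ - c v = ζ²(c w₀ - c v)`),
`Σⱼ F(a,{v,wⱼ},x_c,5/8-2) = ((c w₀ - c v)/(c c₀ - c u))² · bel`. -/
theorem starSum_eq_of_cw {Λ : Finset HexVertex} {u c₀ v w₀ w₁ w₂ : HexVertex} (hu : u ∉ Λ)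
    (h : IsStar v w₀ w₁ w₂)
    (hd₁ : hexCenter w₁ - hexCenter v = triZeta ^ 4 * (hexCenter w₀ - hexCenter v))
    (hd₂ : hexCenter w₂ - hexCenter v = triZeta ^ 2 * (hexCenter w₀ - hexCenter v)) :
    hexParafermionicObservable Λ s(u, c₀) xc (5 / 8 - 2) s(v, w₀) +
        hexParafermionicObservable Λ s(u, c₀) xc (5 / 8 - 2) s(v, w₁) +
        hexParafermionicObservable Λ s(u, c₀) xc (5 / 8 - 2) s(v, w₂) =
      ((hexCenter w₀ - hexCenter v) / (hexCenter c₀ - hexCenter u)) ^ 2 * bel Λ s(u, c₀) v w₀ w₁ w₂ := by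
  obtain ⟨h₀, h₁, h₂, -, -, -⟩ := h
  have hd₂' : hexCenter w₁ - hexCenter v = (triZeta ^ 2) ^ 2 * (hexCenter w₀ - hexCenter v) := by
    rw [hd₁, ← pow_mul]
  have key := starSum_spin_sub_two (Λ := Λ) (u := u) (w₁ := c₀) (v := v) (p₀ := w₀) (p₁ := w₂) (p₂ := w₁)
    (ω := triZeta ^ 2) hu h₀ h₂ h₁ (by rw [← pow_mul]; exact triZeta_pow_six) hd₂ hd₂' xc (5 / 8)
  -- reorder the star sum and identify `bel`
  unfold bel Fobs
  rw [omega_eq_triZeta_sq]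
  linear_combination key

/-- **The dichotomy.** For a simply connected `Λ`, boundary root `{u, c₀}` and `v ∈ Λ`, EVERY labelling of the
star has Beltrami mode either `0` or equal, up to a unimodular factor, to the spin `-11/8` star sum. -/
theorem bel_dichotomy {Λ : Finset HexVertex} {u c₀ v w₀ w₁ w₂ : HexVertex}
    (hΛ : hexDomainSimplyConnected Λ) (hu : u ∉ Λ) (hc₀ : c₀ ∈ Λ) (huc : hexGraph.Adj u c₀) (hv : v ∈ Λ)
    (h : IsStar v w₀ w₁ w₂) :
    bel Λ s(u, c₀) v w₀ w₁ w₂ = 0 ∨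
      hexParafermionicObservable Λ s(u, c₀) xc (5 / 8 - 2) s(v, w₀) +
          hexParafermionicObservable Λ s(u, c₀) xc (5 / 8 - 2) s(v, w₁) +
          hexParafermionicObservable Λ s(u, c₀) xc (5 / 8 - 2) s(v, w₂) =
        ((hexCenter w₀ - hexCenter v) / (hexCenter c₀ - hexCenter u)) ^ 2 * bel Λ s(u, c₀) v w₀ w₁ w₂ := by
  obtain ⟨h₀, h₁, h₂, h01, h12, h02⟩ := h
  rcases hexStar_directions h₀ h₁ h₂ h01 h12 h02 with ⟨hd₁, hd₂⟩ | ⟨hd₁, hd₂⟩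
  · exact Or.inl (bel_eq_zero_of_ccw hΛ hu hc₀ huc hv ⟨h₀, h₁, h₂, h01, h12, h02⟩ hd₁ hd₂)
  · exact Or.inr (starSum_eq_of_cw hu ⟨h₀, h₁, h₂, h01, h12, h02⟩ hd₁ hd₂)

/-- The unimodular factor: `|(c w₀ - c v)/(c c₀ - c u)| = 1` for adjacent pairs. -/
theorem norm_ratio_eq_one {u c₀ v w₀ : HexVertex} (huc : hexGraph.Adj u c₀) (h₀ : hexGraph.Adj v w₀) :
    ‖(hexCenter w₀ - hexCenter v) / (hexCenter c₀ - hexCenter u)‖ = 1 := by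
  rw [norm_div, norm_hexCenter_sub_of_adj h₀, norm_hexCenter_sub_of_adj huc, div_self]
  exact inv_ne_zero (Real.sqrt_ne_zero'.2 (by norm_num))

/-- **`‖bel‖ ≤ ‖S_{-11/8}‖` for every labelling** (simply connected `Λ`, boundary root, `v ∈ Λ`). -/
theorem norm_bel_le_norm_starSum {Λ : Finset HexVertex} {u c₀ v w₀ w₁ w₂ : HexVertex}
    (hΛ : hexDomainSimplyConnected Λ) (hu : u ∉ Λ) (hc₀ : c₀ ∈ Λ) (huc : hexGraph.Adj u c₀) (hv : v ∈ Λ)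
    (h : IsStar v w₀ w₁ w₂) :
    ‖bel Λ s(u, c₀) v w₀ w₁ w₂‖ ≤
      ‖hexParafermionicObservable Λ s(u, c₀) xc (5 / 8 - 2) s(v, w₀) +
          hexParafermionicObservable Λ s(u, c₀) xc (5 / 8 - 2) s(v, w₁) +
          hexParafermionicObservable Λ s(u, c₀) xc (5 / 8 - 2) s(v, w₂)‖ := by
  rcases bel_dichotomy hΛ hu hc₀ huc hv h with hb | hb
  · rw [hb, norm_zero]; exact norm_nonneg _
  · rw [hb, norm_mul, norm_pow, norm_ratio_eq_one huc h.1, one_pow, one_mul]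

/-- **`‖S_{-11/8}‖` is `‖bel‖` for one of the two labellings `(w₀,w₁,w₂)`, `(w₀,w₂,w₁)`.** -/
theorem norm_starSum_eq_norm_bel_or {Λ : Finset HexVertex} {u c₀ v w₀ w₁ w₂ : HexVertex}
    (hu : u ∉ Λ) (huc : hexGraph.Adj u c₀) (h : IsStar v w₀ w₁ w₂) :
    ‖hexParafermionicObservable Λ s(u, c₀) xc (5 / 8 - 2) s(v, w₀) +
          hexParafermionicObservable Λ s(u, c₀) xc (5 / 8 - 2) s(v, w₁) +
          hexParafermionicObservable Λ s(u, c₀) xc (5 / 8 - 2) s(v, w₂)‖ = ‖bel Λ s(u, c₀) v w₀ w₁ w₂‖ ∨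
    ‖hexParafermionicObservable Λ s(u, c₀) xc (5 / 8 - 2) s(v, w₀) +
          hexParafermionicObservable Λ s(u, c₀) xc (5 / 8 - 2) s(v, w₁) +
          hexParafermionicObservable Λ s(u, c₀) xc (5 / 8 - 2) s(v, w₂)‖ = ‖bel Λ s(u, c₀) v w₀ w₂ w₁‖ := by
  obtain ⟨h₀, h₁, h₂, h01, h12, h02⟩ := h
  rcases hexStar_directions h₀ h₁ h₂ h01 h12 h02 with ⟨hd₁, hd₂⟩ | ⟨hd₁, hd₂⟩
  · -- `(w₀, w₂, w₁)` is clockwise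
    right
    have key := starSum_eq_of_cw (Λ := Λ) (c₀ := c₀) hu ⟨h₀, h₂, h₁, h02, h12.symm, h01⟩ hd₂ hd₁
    rw [show hexParafermionicObservable Λ s(u, c₀) xc (5 / 8 - 2) s(v, w₀) +
          hexParafermionicObservable Λ s(u, c₀) xc (5 / 8 - 2) s(v, w₁) +
          hexParafermionicObservable Λ s(u, c₀) xc (5 / 8 - 2) s(v, w₂) =
        hexParafermionicObservable Λ s(u, c₀) xc (5 / 8 - 2) s(v, w₀) +
          hexParafermionicObservable Λ s(u, c₀) xc (5 / 8 - 2) s(v, w₂) +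
          hexParafermionicObservable Λ s(u, c₀) xc (5 / 8 - 2) s(v, w₁) by ring, key, norm_mul, norm_pow,
      norm_ratio_eq_one huc h₀, one_pow, one_mul]
  · left
    rw [starSum_eq_of_cw hu ⟨h₀, h₁, h₂, h01, h12, h02⟩ hd₁ hd₂, norm_mul, norm_pow,
      norm_ratio_eq_one huc h₀, one_pow, one_mul]

/-! ### S4 ⟺ its two-point form -/

/-- **The clean core S4 is equivalent to its two-point form** (registered sub-goal of the crux): flattening of
one-mouth balls for ALL labellings ⟺ ONE inequality `‖Σⱼ F_{-11/8}{v,wⱼ}‖ ≤ e ‖Σⱼ F_{5/8}{v,wⱼ}‖` per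
configuration (one positive winding law, two frequencies). -/
theorem oneMouthBallFlattening_iff_twoPoint :
    (∀ η : ℝ, 0 < η → η ≤ 1 → ∀ e : ℝ, 0 < e → ∃ r₀ : ℝ, ∀ r : ℝ, r₀ ≤ r →
      ∀ (D : Finset HexVertex) (u u' v : HexVertex), hexDomainSimplyConnected D →
        (∀ w ∈ D, dist (hexCenter w) (hexCenter v) ≤ r) → Deep D v (η * r) →
        hexGraph.Adj u u' → r < dist (hexCenter u) (hexCenter v) → u' ∈ D →
        ∀ w₀ w₁ w₂ : HexVertex, IsStar v w₀ w₁ w₂ →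
          ‖bel D s(u, u') v w₀ w₁ w₂‖ ≤ e * ‖mono D s(u, u') v w₀ w₁ w₂‖) ↔
    (∀ η : ℝ, 0 < η → η ≤ 1 → ∀ e : ℝ, 0 < e → ∃ r₀ : ℝ, ∀ r : ℝ, r₀ ≤ r →
      ∀ (D : Finset HexVertex) (u u' v : HexVertex), hexDomainSimplyConnected D →
        (∀ w ∈ D, dist (hexCenter w) (hexCenter v) ≤ r) → Deep D v (η * r) →
        hexGraph.Adj u u' → r < dist (hexCenter u) (hexCenter v) → u' ∈ D →
        ∀ w₀ w₁ w₂ : HexVertex, IsStar v w₀ w₁ w₂ →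
          ‖hexParafermionicObservable D s(u, u') xc (5 / 8 - 2) s(v, w₀) +
              hexParafermionicObservable D s(u, u') xc (5 / 8 - 2) s(v, w₁) +
              hexParafermionicObservable D s(u, u') xc (5 / 8 - 2) s(v, w₂)‖ ≤
            e * ‖mono D s(u, u') v w₀ w₁ w₂‖) := by
  constructor
  · intro H η hη hη1 e he
    obtain ⟨r₀, hr₀⟩ := H η hη hη1 e he
    refine ⟨r₀, fun r hr D u u' v hD hDr hdeep huu' hur hu' w₀ w₁ w₂ hst => ?_⟩
    have hu : u ∉ D := fun huD => absurd (hDr u huD) (not_le.2 hur)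
    have hmono : mono D s(u, u') v w₀ w₂ w₁ = mono D s(u, u') v w₀ w₁ w₂ := by unfold mono; ring
    rcases norm_starSum_eq_norm_bel_or (Λ := D) hu huu' hst with hh | hh
    · rw [hh]; exact hr₀ r hr D u u' v hD hDr hdeep huu' hur hu' w₀ w₁ w₂ hst
    · rw [hh, ← hmono]
      obtain ⟨h₀, h₁, h₂, h01, h12, h02⟩ := hst
      exact hr₀ r hr D u u' v hD hDr hdeep huu' hur hu' w₀ w₂ w₁ ⟨h₀, h₂, h₁, h02, h12.symm, h01⟩
  · intro H η hη hη1 e he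
    obtain ⟨r₀, hr₀⟩ := H η hη hη1 e he
    refine ⟨max r₀ 0, fun r hr D u u' v hD hDr hdeep huu' hur hu' w₀ w₁ w₂ hst => ?_⟩
    have hr0 : 0 ≤ r := le_trans (le_max_right _ _) hr
    have hu : u ∉ D := fun huD => absurd (hDr u huD) (not_le.2 hur)
    have hv : v ∈ D := hdeep v (by rw [dist_self]; positivity)
    exact (norm_bel_le_norm_starSum hD hu hu' huu' hv hst).trans
      (hr₀ r (le_trans (le_max_left _ _) hr) D u u' v hD hDr hdeep huu' hur hu' w₀ w₁ w₂ hst)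

/-! ### The crux ⟺ its two-point form -/

/-- **(M) is equivalent to its two-point form** (registered sub-goal of the crux; the transfer `C⁺ ↔ crux` of the
sibling line `winding-zero-condensation`, proved): `InteriorFlattening` ⟺ `∀ ε ∃ R ∀ Λ` simply connected,
`a ∈ ∂Λ`, `v` with its `R`-ball in `Λ`, distinct neighbours `w₀ w₁ w₂`:
`‖Σⱼ F(a,{v,wⱼ},x_c,-11/8)‖ ≤ ε ‖Σⱼ F(a,{v,wⱼ},x_c,5/8)‖`. -/
theorem interiorFlattening_iff_twoPoint :
    Summit.CriticalPhenomena.SAWScalingLimit.Theses.SAWDevelopingMap.InteriorFlattening ↔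
    (∀ ε : ℝ, 0 < ε → ∃ R : ℝ, ∀ (Λ : Finset HexVertex), hexDomainSimplyConnected Λ →
      ∀ a ∈ hexDomainBoundary Λ, ∀ v ∈ Λ,
        (∀ w : HexVertex, dist (hexCenter w) (hexCenter v) ≤ R → w ∈ Λ) →
        ∀ w₀ w₁ w₂ : HexVertex, hexGraph.Adj v w₀ → hexGraph.Adj v w₁ → hexGraph.Adj v w₂ →
          w₀ ≠ w₁ → w₁ ≠ w₂ → w₀ ≠ w₂ →
          ‖hexParafermionicObservable Λ a hexCriticalFugacity (5 / 8 - 2) s(v, w₀) +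
              hexParafermionicObservable Λ a hexCriticalFugacity (5 / 8 - 2) s(v, w₁) +
              hexParafermionicObservable Λ a hexCriticalFugacity (5 / 8 - 2) s(v, w₂)‖ ≤
            ε * ‖hexParafermionicObservable Λ a hexCriticalFugacity (5 / 8) s(v, w₀) +
              hexParafermionicObservable Λ a hexCriticalFugacity (5 / 8) s(v, w₁) +
              hexParafermionicObservable Λ a hexCriticalFugacity (5 / 8) s(v, w₂)‖) := by
  constructor
  · intro H ε hε
    obtain ⟨R, hR⟩ := H ε hε
    refine ⟨R, fun Λ hΛ a ha v hv hball w₀ w₁ w₂ h₀ h₁ h₂ h01 h12 h02 => ?_⟩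
    obtain ⟨hae, u, c₀, rfl, hc₀, hu⟩ := ha
    have huc : hexGraph.Adj u c₀ := by simpa using hae
    have ha' : s(u, c₀) ∈ hexDomainBoundary Λ := ⟨hae, u, c₀, rfl, hc₀, hu⟩
    -- the crux at the labelling realising `‖S_{-11/8}‖ = ‖bel‖`
    have hM : ∀ p q r' : HexVertex, IsStar v p q r' →
        ‖bel Λ s(u, c₀) v p q r'‖ ≤ ε * ‖mono Λ s(u, c₀) v p q r'‖ := by
      intro p q r' hst
      obtain ⟨hp, hq, hr', hpq, hqr, hpr⟩ := hst
      have := hR Λ hΛ _ ha' v hv hball p q r' hp hq hr' hpq hqr hpr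
      dsimp only at this
      unfold bel mono Fobs omega
      exact this
    have hmono : ∀ p q r' : HexVertex, mono Λ s(u, c₀) v p r' q = mono Λ s(u, c₀) v p q r' := by
      intro p q r'; unfold mono; ring
    have hst : IsStar v w₀ w₁ w₂ := ⟨h₀, h₁, h₂, h01, h12, h02⟩
    have hgoal : ‖hexParafermionicObservable Λ s(u, c₀) xc (5 / 8 - 2) s(v, w₀) +
          hexParafermionicObservable Λ s(u, c₀) xc (5 / 8 - 2) s(v, w₁) +
          hexParafermionicObservable Λ s(u, c₀) xc (5 / 8 - 2) s(v, w₂)‖ ≤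
        ε * ‖mono Λ s(u, c₀) v w₀ w₁ w₂‖ := by
      rcases norm_starSum_eq_norm_bel_or (Λ := Λ) hu huc hst with hh | hh
      · rw [hh]; exact hM w₀ w₁ w₂ hst
      · rw [hh, ← hmono]; exact hM w₀ w₂ w₁ ⟨h₀, h₂, h₁, h02, h12.symm, h01⟩
    unfold mono Fobs at hgoal
    exact hgoal
  · intro H ε hε
    obtain ⟨R, hR⟩ := H ε hε
    refine ⟨R, fun Λ hΛ a ha v hv hball w₀ w₁ w₂ h₀ h₁ h₂ h01 h12 h02 => ?_⟩
    dsimp only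
    obtain ⟨hae, u, c₀, rfl, hc₀, hu⟩ := ha
    have huc : hexGraph.Adj u c₀ := by simpa using hae
    have ha' : s(u, c₀) ∈ hexDomainBoundary Λ := ⟨hae, u, c₀, rfl, hc₀, hu⟩
    have hst : IsStar v w₀ w₁ w₂ := ⟨h₀, h₁, h₂, h01, h12, h02⟩
    have h1 := norm_bel_le_norm_starSum hΛ hu hc₀ huc hv hst
    have h2 := hR Λ hΛ _ ha' v hv hball w₀ w₁ w₂ h₀ h₁ h₂ h01 h12 h02
    unfold bel Fobs at h1
    rw [omega_eq_triZeta_sq] at h1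
    rw [cexp_two_pi_I_div_three]
    exact h1.trans h2

end Summit.CriticalPhenomena.SAWScalingLimit.Theorems.InteriorFlattening.OneMouth

end
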